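import Mathlib
import Literature.RingTheory.MvPolynomial.GrobnerDegeneration
import Literature.RingTheory.MvPolynomial.WeightMonomialOrder
import Literature.RingTheory.MvPolynomial.LeadingExponents
import Summits.ResolutionOfSingularities.ResolutionOfSingularities.Theorems.TropicalLinksSchonResolvesMonicStandardTail

/-!
# TropicalLinks / SchonResolves — leading monomials reduce to standard `k[t]`-combinations
# modulo the Gröbner degeneration ideal (spanning half of KERNEL (P1))

Route `ResolutionOfSingularities/TropicalLinks`, crux `SchonResolves`
(stmt-ResolutionOfSingularities-17234), line `zariski-toric-closure`, the SPANNING half of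
KERNEL (P1) ("inside a Gröbner cone the Gröbner degeneration `k[t][x] ⧸ grobnerDegeneration W I`
is free over `k[t] = MvPolynomial ι k` with basis the standard monomials `{x^a : a ∉ E_m(I)}`",
Eisenbud, *Commutative Algebra*, §15.8, Thm. 15.17; several weights as in Maclagan–Sturmfels
§2.4–2.5).

* `schonResolves_weightedTotalDegree_eq_weight_of_standard_tail` — the CONE CONDITION at work:
  if `E_{≺_{w,m}}(I) = E_m(I)` and `g ∈ I` has `coeff_u g ≠ 0` and all its other exponents
  standard, then the `w`-weighted total degree of `g` is `⟨w, u⟩` (the `≺_{w,m}`-leading exponent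
  of `g` lies in `E(I) ∩ supp g = {u}`, and it has maximal weight, tree lemma
  `weight_degree_weightLex`);
* `schonResolves_grobnerDegeneration_monomial_sub_standard_mem` (registered stub) — **for
  `u ∈ E_m(I)` there is `r ∈ k[t][x]` supported on standard monomials with
  `x^u - r ∈ grobnerDegeneration W I`**: take the monic standard-tail representative
  `g = x^u - r₀ ∈ I` (tree lemma `schonResolves_exists_sub_mem_forall_notMem_leadingExponents`);
  by the previous item `twistExponent W g u = 0`, so the twist `twist W g ∈ grobnerDegeneration W I`
  has `[x^u] twist W g = 1` and `r := x^u - twist W g` is supported on `supp r₀`, which is standard.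

No new definitions.
-/

-- single-problem summit: the doubled namespace component `ResolutionOfSingularities` is forced
set_option linter.dupNamespace false

namespace Summit.ResolutionOfSingularities.ResolutionOfSingularities.Theorems

open MvPolynomial Literature.RingTheory.MvPolynomial

section MonomialSubStandard

/-- **The cone condition pins the weighted degree of a standard-tail member.** If the leading
exponents of `I` for the weight order `≺_{w,m}` and for `m` agree, `g ∈ I` has `coeff_u g ≠ 0`
and every other exponent of `g` is standard (not in `E_m(I)`), then the `w`-weighted total degree
of `g` equals `⟨w, u⟩`: the `≺_{w,m}`-leading exponent of `g` is a leading exponent of `I` in the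
support of `g`, hence it is `u`, and it carries the maximal weight. [cite: Sturmfels1996GBCP, Ch. 1] -/
theorem schonResolves_weightedTotalDegree_eq_weight_of_standard_tail {k : Type*} [Field k]
    {σ : Type*} (w : σ → ℕ) (m : MonomialOrder σ) {I : Ideal (MvPolynomial σ k)}
    (hcone : leadingExponents (weightLex w m) I = leadingExponents m I)
    {g : MvPolynomial σ k} (hgI : g ∈ I) {u : σ →₀ ℕ} (hgu : g.coeff u ≠ 0)
    (htail : ∀ a ∈ g.support, a ≠ u → a ∉ leadingExponents m I) :
    weightedTotalDegree w g = Finsupp.weight w u := by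
  have hg0 : g ≠ 0 := fun h => hgu (by rw [h, coeff_zero])
  -- the `≺_{w,m}`-leading exponent of `g` lies in `E(I)` and in `supp g`, so it is `u`
  have hd : (weightLex w m).degree g = u := by
    by_contra hne
    refine htail _ ((weightLex w m).degree_mem_support hg0) hne ?_
    rw [← hcone]
    exact ⟨g, hgI, hg0, rfl⟩
  rw [← weight_degree_weightLex (w := w) (m := m) hg0, hd]

/-- **P1-span: leading monomials reduce to standard `k[t]`-combinations modulo the Gröbner
degeneration ideal.** For a field `k`, natural weights `W i` (`i : ι`) lying in one Gröbner cone
of `I ⊆ k[x_σ]` for the monomial order `m` (i.e. `E_{≺_{W i,m}}(I) = E_m(I)` for all `i`) and a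
leading exponent `u ∈ E_m(I)`, there is `r ∈ k[t_ι][x_σ]` all of whose `x`-exponents are standard
with `x^u - r ∈ grobnerDegeneration W I`: `x^u - r` is the twist `t^{μ(g)} g(t^{-W} x)` of the
monic standard-tail representative `g = x^u - r₀ ∈ I`, whose `t`-exponent in front of `x^u`
vanishes by the cone condition. [cite: Eisenbud1995, §15.8, Thm. 15.17] -/
theorem schonResolves_grobnerDegeneration_monomial_sub_standard_mem : ∀ (k : Type) [Field k] (σ ι : Type) [Fintype ι] [DecidableEq ι] (W : ι → σ → ℕ) (m : MonomialOrder σ) (I : Ideal (MvPolynomial σ k)), (∀ i : ι, Literature.RingTheory.MvPolynomial.leadingExponents (Literature.RingTheory.MvPolynomial.weightLex (W i) m) I = Literature.RingTheory.MvPolynomial.leadingExponents m I) → ∀ u ∈ Literature.RingTheory.MvPolynomial.leadingExponents m I, ∃ r : MvPolynomial σ (MvPolynomial ι k), (∀ a ∈ r.support, a ∉ Literature.RingTheory.MvPolynomial.leadingExponents m I) ∧ MvPolynomial.monomial u 1 - r ∈ Literature.RingTheory.MvPolynomial.grobnerDegeneration W I := by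
  intro k _ σ ι _ _ W m I hcone u hu
  classical
  -- the monic standard-tail representative `g := x^u - r₀ ∈ I`
  obtain ⟨r₀, hgI, hr₀⟩ :=
    schonResolves_exists_sub_mem_forall_notMem_leadingExponents m I (monomial u (1 : k))
  -- `u ∈ E(I)` is not an exponent of `r₀`, so `coeff_u g = 1`
  have hru : r₀.coeff u = 0 := by
    by_contra h
    exact hr₀ u (mem_support_iff.mpr h) hu
  have hgu : (monomial u (1 : k) - r₀).coeff u = 1 := by
    rw [coeff_sub, coeff_monomial, if_pos rfl, hru, sub_zero]
  -- every exponent of `g` other than `u` is an exponent of `r₀`, hence standard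
  have htail : ∀ a ∈ (monomial u (1 : k) - r₀).support, a ≠ u →
      a ∉ leadingExponents m I := by
    intro a ha hau
    rcases Finset.mem_union.mp (support_sub σ _ r₀ ha) with h | h
    · exact absurd (Finset.mem_singleton.mp (support_monomial_subset h)) hau
    · exact hr₀ a h
  -- cone condition: the `t`-exponent of the twist in front of `x^u` vanishes
  have htwu : twistExponent W (monomial u (1 : k) - r₀) u = 0 := by
    ext i
    rw [twistExponent_apply, schonResolves_weightedTotalDegree_eq_weight_of_standard_tail (W i) m
      (hcone i) hgI (by rw [hgu]; exact one_ne_zero) htail, tsub_self]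
    rfl
  refine ⟨monomial u 1 - twist W (monomial u (1 : k) - r₀), ?_, ?_⟩
  · -- `x^u - twist W g` is supported on `supp r₀`
    intro a ha
    rw [mem_support_iff, coeff_sub, coeff_monomial, coeff_twist] at ha
    by_cases hau : u = a
    · subst hau
      rw [if_pos rfl, htwu, hgu] at ha
      exact absurd (by rw [← C_apply, C_1, sub_self]) ha
    · rw [if_neg hau, zero_sub, neg_ne_zero, Ne, monomial_eq_zero] at ha
      exact htail a (mem_support_iff.mpr ha) (Ne.symm hau)
  · -- `x^u - (x^u - twist W g) = twist W g ∈ grobnerDegeneration W I`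
    rw [sub_sub_cancel]
    exact twist_mem_grobnerDegeneration hgI

end MonomialSubStandard

end Summit.ResolutionOfSingularities.ResolutionOfSingularities.Theorems
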